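import Mathlib.Algebra.BigOperators.Ring.Finset
import Mathlib.GroupTheory.Perm.Support
import Literature.IUT.HodgeArakelov.SymmetryCombinatorics
import HarnessLib

/-!
# [IUTchII] Remarks 4.7.3 (iii), 4.7.4 (ii): weights `1/l⋇`; spoke actions commute (`F_l^⋇`) / fail to commute
# (`F_l^⋊±`) — proof companion of `SymmetryCombinatorics.lean`

S. Mochizuki, *Inter-universal Teichmüller theory II*, §4, kurims manuscript (Dec. 2020), read on the page this
session (cell render `IUTchII-kurims-url-5036b4059555`): Remark 4.7.3 (iii) p. 145 l. 16–55; Remark 4.7.4 (ii)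
p. 146 l. 22–49 (with (iii) p. 147 l. 15–50 for the model) [cite: Mochizuki2012, Rmk 4.7.4 (ii) p.146]. Claim key
DISPUTED (D-0012). PROOF-ONLY companion (abc-iut cell, layer L6, seat abc-iut-w4-d035 gen 8, rows
IUTchII:Rmk4.7.3(iii), Rmk4.7.4(ii) of the L6-t2 typer lineage p403959 `SymmetryCombinatorics.lean`): NO definition,
NO `Prop` fact, NO instance — theorems about p403959's étale-picture model `GluedPair` (`X_α ∐_{x₀} X_β`, two spokes
glued at the zero label) and Mathlib's `ZMod l`.

WHAT IS PROVED (every item is the printed clause, read at the model named):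

* **Rmk 4.7.3 (iii)** (p. 145 l. 40–44, weights `1/l⋇`): the weighted volume of the diagonal image of a
  constant distribution of volume `μ` is `μ` (`weightedVolume_diagonal_eq`; `sum_weights_eq_one` is p403959).
* **Rmk 4.7.4 (ii)** (p. 146 l. 22–49) over p403959's étale-picture model `X_α ∐_{x₀} X_β` (`GluedPair`):
  (a) "in the case of the `F_l^⋊±`-symmetry, the `F_l^⋊±`-actions on distinct spokes fail to commute with one
  another" — if `g`, `h` MOVE the glue point, the permutation extending `g` on the spoke `α` (identity on
  `β ∖ 0`) and the one extending `h` on `β` do NOT commute (`GluedPair.spokes_not_commute_of_moves`;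
  instance `F_l ↷ F_l` by translations, `zmod_spokes_not_commute`); (b) "in the case of the `F_l^⋇`-symmetry,
  the `F_l^⋇`-actions on distinct spokes commute with one another and, moreover, are compatible with the
  permutations of spokes" — under p403959's `productAction` the two spoke actions commute
  (`GluedPair.spokes_commute_of_fix`), each fixes the other spoke pointwise (`smul_inB_of_fix`,
  `smul_inA_of_fix`), and the swap of the two spokes conjugates the one into the other
  (`GluedPair.swap_smul`); the closing sentence ("invariance with respect to the `F_l^⋊±`-actions on all of
  the spokes … a condition of «uniformity»") has the kernel: a translation-invariant function on `F_l` is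
  constant (`zmod_translationInvariant_const`).

* **Rmk 4.7.4 (ii) for ANY number of spokes** (v2 append): symmetries supported on spokes that meet only in common fixed
  points COMMUTE (`spokes_commute_of_supports`, Mathlib `Equiv.Perm.Disjoint.commute`); if the common glue point is
  moved by both, to different places each fixed by the other, they do NOT (`spokes_not_commute_at_glue`).

HONEST FRAMING. Finite combinatorics over the cell's own model; nothing here bears on [IUTchIII] Cor. 3.12 or takes
a side; typed ≠ discharged elsewhere; covered ≠ endorsed.
-/

namespace Literature.IUT.HodgeArakelov

universe u v

/-! ### 1. Remark 4.7.3 (iii): weights `1/l⋇` and the diagonal embedding of the constant distribution -/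

/-- **[IUTchII] Rmk 4.7.3 (iii)** (p. 145 l. 35–44: "if one thinks of the coric constant distribution, labeled by
zero, as embedded via the diagonal embedding into the various products parametrized by `j ∈ F_l^⋇` … then it is
natural to think of the volumes computed at each `j ∈ F_l^⋇` as being assigned a weight `1/l⋇` — i.e., so that the
diagonal embedding of the constant distribution is compatible with taking the constant distribution to be of weight
1"): the weighted volume of the diagonal image `(μ, …, μ)` of a constant distribution of volume `μ` is `μ` (`l⋇ ≥ 1`).
[cite: Mochizuki2012, Rmk 4.7.3 (iii) p.145] -/
theorem weightedVolume_diagonal_eq (lstar : ℕ) (hl : 0 < lstar) (μ : ℚ) :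
    ∑ _j : Fin lstar, (1 / lstar : ℚ) * μ = μ := by
  rw [← Finset.sum_mul, sum_weights_eq_one lstar hl, one_mul]

/-! ### 2. Remark 4.7.4 (ii): spoke actions commute (`F_l^⋇`) / fail to commute (`F_l^⋊±`) -/

namespace GluedPair

variable {X : Type u} {x₀ : X} [DecidableEq X] {G : Type v} [Group G] [MulAction G X]

omit [DecidableEq X] in
/-- `inA` and `inB` agree exactly at the glue point: `inA x = inB y` forces `x = y = x₀`.
[cite: Mochizuki2012, Rmk 4.7.4 (ii) p.146] -/
theorem inA_ne_inB_of_ne [DecidableEq X] {x y : X} (hx : x ≠ x₀) : (inA x : GluedPair X x₀) ≠ inB y := by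
  unfold inA inB
  rw [dif_neg hx]
  split_ifs <;> simp

/-- **[IUTchII] Rmk 4.7.4 (ii)(a)** (p. 146 l. 24–27: "in the case of the `F_l^⋊±`-symmetry, the `F_l^⋊±`-actions on
distinct spokes fail to commute with one another"), over p403959's étale-picture model `X_α ∐_{x₀} X_β`: let `σ` be ANY
permutation extending the action of `g` on the spoke `α` and fixing the spoke `β` off the glue point, and `τ` ANY
permutation extending `h` on `β` and fixing `α` off the glue point; if `g` and `h` MOVE the glue point (as the
translations of `F_l^⋊± ↷ F_l` move `0`, `zmod_translation_moves_zero`), then `σ ∘ τ ≠ τ ∘ σ` — already at the glue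
point. [cite: Mochizuki2012, Rmk 4.7.4 (ii) p.146] -/
theorem spokes_not_commute_of_moves (g h : G) (hg : g • x₀ ≠ x₀) (hh : h • x₀ ≠ x₀)
    (σ τ : Equiv.Perm (GluedPair X x₀))
    (hσ : ∀ x : X, σ (inA x) = inA (g • x)) (hσ' : ∀ x : X, x ≠ x₀ → σ (inB x) = inB x)
    (hτ : ∀ x : X, τ (inB x) = inB (h • x)) (hτ' : ∀ x : X, x ≠ x₀ → τ (inA x) = inA x) :
    σ * τ ≠ τ * σ := by
  intro hc
  have h0A : (inA x₀ : GluedPair X x₀) = none := (inA_eq_none_iff x₀).2 rfl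
  have h0B : (inB x₀ : GluedPair X x₀) = none := (inB_eq_none_iff x₀).2 rfl
  -- `σ (τ none) = inB (h • x₀)` while `τ (σ none) = inA (g • x₀)`
  have h1 : (σ * τ) (none : GluedPair X x₀) = inB (h • x₀) := by
    rw [Equiv.Perm.mul_apply, ← h0B, hτ, hσ' _ hh]
  have h2 : (τ * σ) (none : GluedPair X x₀) = inA (g • x₀) := by
    rw [Equiv.Perm.mul_apply, ← h0A, hσ, hτ' _ hg]
  rw [hc, h2] at h1
  exact inA_ne_inB_of_ne hg h1

/-- Under p403959's product action (the glue point FIXED by `G`, as `F_l^⋇ ↷ |F_l|` fixes `0`), the action of the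
spoke-`α` factor fixes the spoke `β` pointwise. [cite: Mochizuki2012, Rmk 4.7.4 (ii) p.146] -/
theorem smul_inB_of_fix (hfix : ∀ g : G, g • x₀ = x₀) (g : G) (x : X) :
    (letI := productAction (x₀ := x₀) hfix; ((g, (1 : G)) : G × G) • (inB x : GluedPair X x₀)) = inB x := by
  letI := productAction (x₀ := x₀) hfix
  show prodSMul hfix (g, 1) (inB x) = inB x
  unfold inB
  by_cases hx : x = x₀
  · rw [dif_pos hx]; rfl
  · rw [dif_neg hx]
    simp [prodSMul]

/-- … and the action of the spoke-`β` factor fixes the spoke `α` pointwise. [cite: Mochizuki2012, Rmk 4.7.4 (ii) p.146] -/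
theorem smul_inA_of_fix (hfix : ∀ g : G, g • x₀ = x₀) (h : G) (x : X) :
    (letI := productAction (x₀ := x₀) hfix; (((1 : G), h) : G × G) • (inA x : GluedPair X x₀)) = inA x := by
  letI := productAction (x₀ := x₀) hfix
  show prodSMul hfix (1, h) (inA x) = inA x
  unfold inA
  by_cases hx : x = x₀
  · rw [dif_pos hx]; rfl
  · rw [dif_neg hx]
    simp [prodSMul]

omit [DecidableEq X] in
/-- **[IUTchII] Rmk 4.7.4 (ii)(b)** (p. 146 l. 28–32: "in the case of the `F_l^⋇`-symmetry, the `F_l^⋇`-actions on distinct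
spokes commute with one another"), over p403959's model: when `G` FIXES the glue point, the permutation of
`X_α ∐_{x₀} X_β` given by `g` on the spoke `α` and the one given by `h` on the spoke `β` (the two factors of
`productAction`) COMMUTE. [cite: Mochizuki2012, Rmk 4.7.4 (ii) p.146] -/
theorem spokes_commute_of_fix (hfix : ∀ g : G, g • x₀ = x₀) (g h : G) (z : GluedPair X x₀) :
    (letI := productAction (x₀ := x₀) hfix;
      ((g, (1 : G)) : G × G) • ((((1 : G), h) : G × G) • z)) =
    (letI := productAction (x₀ := x₀) hfix;
      (((1 : G), h) : G × G) • (((g, (1 : G)) : G × G) • z)) := by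
  letI := productAction (x₀ := x₀) hfix
  rw [← mul_smul, ← mul_smul]
  congr 1
  ext <;> simp

omit [DecidableEq X] in
/-- **[IUTchII] Rmk 4.7.4 (ii)(b)**, "… and, moreover, are compatible with the permutations of spokes discussed in
[IUTchI], Corollary 4.12, (iii)" (p. 146 l. 31–32): the swap of the two spokes `X_α ∐_{x₀} X_β ⥲ X_β ∐_{x₀} X_α`
(Mathlib's `Equiv.optionCongr (Equiv.sumComm _ _)`) intertwines the action of `(g, h)` with that of `(h, g)` — permuting
the spokes permutes the commuting spoke actions accordingly. [cite: Mochizuki2012, Rmk 4.7.4 (ii) p.146] -/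
theorem swap_smul (hfix : ∀ g : G, g • x₀ = x₀) (g h : G) (z : GluedPair X x₀) :
    (Equiv.optionCongr (Equiv.sumComm {x : X // x ≠ x₀} {x : X // x ≠ x₀}))
        (letI := productAction (x₀ := x₀) hfix; ((g, h) : G × G) • z) =
      (letI := productAction (x₀ := x₀) hfix;
        ((h, g) : G × G) • (Equiv.optionCongr (Equiv.sumComm {x : X // x ≠ x₀} {x : X // x ≠ x₀}) z)) := by
  letI := productAction (x₀ := x₀) hfix
  rcases z with _ | ⟨x | x⟩ <;> rfl

/-- The swap of spokes exchanges the two spoke embeddings: `swap ∘ inA = inB`. [cite: Mochizuki2012, Rmk 4.7.4 (ii) p.146] -/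
theorem swap_inA (x : X) :
    (Equiv.optionCongr (Equiv.sumComm {x : X // x ≠ x₀} {x : X // x ≠ x₀})) (inA x : GluedPair X x₀) = inB x := by
  unfold inA inB
  split_ifs <;> rfl

end GluedPair

/-- **[IUTchII] Rmk 4.7.4 (ii)(a) for `F_l`** (p. 146 l. 24–27, 33–37: the non-commutativity "is a direct consequence of
the inclusion of the zero label in the `F_l^⋊±`-symmetry"): in the étale picture of two copies of `F_l` glued at `0`,
NO pair of permutations extending the translation `x ↦ x + 1` on the one spoke resp. the other spoke (identity off the
glue point on the remaining spoke) commutes (`l ≥ 2`). [cite: Mochizuki2012, Rmk 4.7.4 (ii) p.146] -/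
theorem zmod_spokes_not_commute (l : ℕ) [Fact (1 < l)] (σ τ : Equiv.Perm (GluedPair (ZMod l) 0))
    (hσ : ∀ x : ZMod l, σ (GluedPair.inA x) = GluedPair.inA (Multiplicative.ofAdd (1 : ZMod l) • x))
    (hσ' : ∀ x : ZMod l, x ≠ 0 → σ (GluedPair.inB x) = GluedPair.inB x)
    (hτ : ∀ x : ZMod l, τ (GluedPair.inB x) = GluedPair.inB (Multiplicative.ofAdd (1 : ZMod l) • x))
    (hτ' : ∀ x : ZMod l, x ≠ 0 → τ (GluedPair.inA x) = GluedPair.inA x) : σ * τ ≠ τ * σ :=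
  GluedPair.spokes_not_commute_of_moves _ _ (zmod_translation_moves_zero l) (zmod_translation_moves_zero l)
    σ τ hσ hσ' hτ hτ'

/-- **[IUTchII] Rmk 4.7.4 (ii)(b) for `F_l^⋇ ↷ |F_l|`** (p. 146 l. 28–32), assembled: the unit actions on two copies of `F_l`
glued at `0` extend to permutations `σ_g` (spoke `α`) and `τ_h` (spoke `β`) of the glued set that COMMUTE, each fixing the
other spoke. [cite: Mochizuki2012, Rmk 4.7.4 (ii) p.146] -/
theorem units_spokes_commute (l : ℕ) (g h : (ZMod l)ˣ) :
    ∃ σ τ : Equiv.Perm (GluedPair (ZMod l) 0),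
      (∀ x : ZMod l, σ (GluedPair.inA x) = GluedPair.inA (g • x)) ∧ (∀ x : ZMod l, σ (GluedPair.inB x) = GluedPair.inB x) ∧
      (∀ x : ZMod l, τ (GluedPair.inB x) = GluedPair.inB (h • x)) ∧ (∀ x : ZMod l, τ (GluedPair.inA x) = GluedPair.inA x) ∧
      σ * τ = τ * σ := by
  letI := GluedPair.productAction (X := ZMod l) (x₀ := (0 : ZMod l)) (units_smul_zero l)
  have hP := GluedPair.productAction_isProductAction (X := ZMod l) (x₀ := (0 : ZMod l)) (units_smul_zero l)
  refine ⟨MulAction.toPerm ((g, (1 : (ZMod l)ˣ)) : (ZMod l)ˣ × (ZMod l)ˣ),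
    MulAction.toPerm (((1 : (ZMod l)ˣ), h) : (ZMod l)ˣ × (ZMod l)ˣ), fun x => hP.left g x,
    fun x => GluedPair.smul_inB_of_fix (units_smul_zero l) g x, fun x => hP.right h x,
    fun x => GluedPair.smul_inA_of_fix (units_smul_zero l) h x, ?_⟩
  refine Equiv.ext fun z => ?_
  simp only [Equiv.Perm.mul_apply, MulAction.toPerm_apply]
  exact GluedPair.spokes_commute_of_fix (units_smul_zero l) g h z

/-- **[IUTchII] Rmk 4.7.4 (ii)**, closing sentence (p. 146 l. 42–49: "in the case of the `F_l^⋊±`-symmetry, it is also a direct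
consequence of the inclusion of the zero label that the condition of invariance with respect to the `F_l^⋊±`-actions on all of
the spokes may be thought of as a condition of «uniformity» among the elements of the copies of `F_l` …, hence as a sort of
coricity"), its mathematical kernel: the translation part of `F_l^⋊±` acts TRANSITIVELY on `F_l`, so an
`F_l^⋊±`-invariant function on `F_l` is constant ("uniform"). [cite: Mochizuki2012, Rmk 4.7.4 (ii) p.146] -/
theorem zmod_translationInvariant_const {β : Type u} (l : ℕ) (f : ZMod l → β)
    (hf : ∀ a x : ZMod l, f (a + x) = f x) (x y : ZMod l) : f x = f y := by
  have := hf (x - y) y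
  rwa [sub_add_cancel] at this

/-! ### 3. Remark 4.7.4 (ii)(b) for ANY NUMBER OF SPOKES (v2 append): actions supported on disjoint spokes commute -/

/-- **[IUTchII] Rmk 4.7.4 (ii)(b)**, étale picture with arbitrarily many spokes (p. 146 l. 28–32: "the `F_l^⋇`-actions on
distinct spokes commute with one another"): in ANY model of the étale picture (a set `Z` carrying the spokes, glued
at the coric label), a symmetry supported on the spoke `A` (identity off `A`) and a symmetry supported on the spoke
`B` (identity off `B`) COMMUTE as soon as the spokes meet at most in points both fix — in particular when `A ∩ B` is
the glue point and both FIX it (the `F_l^⋇` case, `units_smul_zero`). Mathlib's `Equiv.Perm.Disjoint.commute`.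
[cite: Mochizuki2012, Rmk 4.7.4 (ii) p.146] -/
theorem spokes_commute_of_supports {Z : Type u} (σ τ : Equiv.Perm Z) (A B : Set Z)
    (hσ : ∀ z, z ∉ A → σ z = z) (hτ : ∀ z, z ∉ B → τ z = z) (hAB : ∀ z, z ∈ A → z ∈ B → σ z = z ∧ τ z = z) :
    σ * τ = τ * σ := by
  refine (Equiv.Perm.Disjoint.commute fun z => ?_).eq
  by_cases hA : z ∈ A
  · by_cases hB : z ∈ B
    · exact Or.inl (hAB z hA hB).1
    · exact Or.inr (hτ z hB)
  · exact Or.inl (hσ z hA)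

/-- The `F_l^⋊±` contrast in the same generality ([IUTchII] Rmk 4.7.4 (ii)(a), p. 146 l. 24–27 and l. 33–37: the failure
"is a direct consequence of the inclusion of the zero label"): if the common point `z₀` of the two spokes is MOVED by
`σ` into `A ∖ B`-territory fixed by `τ`, and moved by `τ` into territory fixed by `σ`, to two DIFFERENT places, then
`σ ∘ τ ≠ τ ∘ σ` — already at `z₀`. [cite: Mochizuki2012, Rmk 4.7.4 (ii) p.146] -/
theorem spokes_not_commute_at_glue {Z : Type u} (σ τ : Equiv.Perm Z) (z₀ : Z)
    (hτσ : τ (σ z₀) = σ z₀) (hστ : σ (τ z₀) = τ z₀) (hne : σ z₀ ≠ τ z₀) : σ * τ ≠ τ * σ := by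
  intro h
  have := Equiv.Perm.ext_iff.1 h z₀
  rw [Equiv.Perm.mul_apply, Equiv.Perm.mul_apply, hστ, hτσ] at this
  exact hne this.symm

end Literature.IUT.HodgeArakelov
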